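import Literature.NumberTheory.Transcendental.GammaIsoCross
import Literature.NumberTheory.Transcendental.GammaIsoTwistedTransfer
import HarnessLib

/-!
# Cross Γ-isomorphisms: transport, transfer, predimension invariance, generic extension

Companion of `GammaIsoCross.lean` (Γ-isomorphisms `GammaField.IsGammaIsoTw₂ σ c c'` between a
tuple `c` of an exponential field `F₁` and a tuple `c'` of a second exponential field `F₂`, over
an isomorphism `σ : ℚ(K₁, exp K₁) ≃ ℚ(K₂, exp K₂)` of base Γ-fields `K₁ ≤ F₁`, `K₂ ≤ F₂`),
porting `GammaIsoTwistedTransfer.lean` (the one-field, two-base version) to two fields.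
M. Bays, J. Kirby, *Pseudo-exponential maps, variants, and quasiminimality*, Algebra & Number
Theory 12 (2018), §3, §4.1 (embeddings of Γ-fields preserve `td`, `ldim`, `δ`), and, for the
generic extension, M. Bays, J. Kirby, *Excellence and uncountable categoricity of Zilber's
exponential fields*, arXiv:1305.0493, Prop. 5 (i) / L. Haykazyan, *Categoricity in
quasiminimal pregeometry classes*, JSL 81 (2016), Def. 2, IV(i) (uniqueness of the generic type
ACROSS two members of the class):

* `IsGammaIsoTw₂.transport` — the map `K₁ + ℚx → K₂ + ℚx'` (a map `F₁ → F₂`, the field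
  isomorphism `IsGammaIsoTw₂.fieldEquiv` on `K₁ + ℚx`, junk `0` elsewhere): `σ` on `K₁`,
  `xᵢ ↦ x'ᵢ`, additive, `ℚ`-linear, commuting with `exp`;
* `IsGammaIsoTw₂.transfer`, `sup_span_transport_eq`, `linIndepOver`, `coe_fieldEquiv_symm_eq`,
  `transport_symm_transport`;
* **predimension invariance across the two fields**: `td_eq_of_transport`, `td_span_eq`,
  `predim_span_eq`, `td_sup_span_eq`, `predim_sup_span_eq`;
* **generic extension across the two fields**: `IsGammaIsoTw₂.append_singleton(_of_not_mem)` —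
  `(c, d) ↦ (c', d')` for `d ∈ F₁`, `d' ∈ F₂` generic over `K₁ + ℚc`, `K₂ + ℚc'`.

Everything is proved; the proofs are those of `GammaIsoTwistedTransfer.lean`, verbatim with the
two fields kept apart.

## References

* M. Bays, J. Kirby, *Pseudo-exponential maps, variants, and quasiminimality*, Algebra & Number
  Theory 12 (2018) 493–549: Def. 3.10, Def. 3.15, Def. 4.1, Lemma 4.13.
* M. Bays, J. Kirby, *Excellence and uncountable categoricity of Zilber's exponential fields*,
  arXiv:1305.0493 (2013): Prop. 5 (i).
* L. Haykazyan, *Categoricity in quasiminimal pregeometry classes*, J. Symbolic Logic 81 (2016):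
  Def. 2.
-/

noncomputable section

open Set

universe u

namespace Literature.NumberTheory.Transcendental

namespace GammaField

open Literature.ModelTheory.ExponentialFields.ExponentialRing ZilberHomogeneity

variable {F₁ : Type u} [Field F₁] [CharZero F₁] [Literature.ModelTheory.ExponentialFields.ExponentialRing F₁]
variable {F₂ : Type u} [Field F₂] [CharZero F₂] [Literature.ModelTheory.ExponentialFields.ExponentialRing F₂]
variable {K₁ : Submodule ℚ F₁} {K₂ : Submodule ℚ F₂} {σ : fieldOf K₁ ≃+* fieldOf K₂} {N : ℕ}
  {x : Fin N → F₁} {x' : Fin N → F₂}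

/-! ### The transport map -/

open Classical in
/-- **The transport map of a cross Γ-isomorphism** `x ↦ x'` over `σ`: on `K₁ + ℚx` it is the
field isomorphism `θ : ⟨K₁ x⟩ ≅ ⟨K₂ x'⟩` (`IsGammaIsoTw₂.fieldEquiv`), elsewhere `0` (junk value).
[cite: BaysKirby2018ANT, Def. 3.10] -/
def IsGammaIsoTw₂.transport (_h : IsGammaIsoTw₂ σ x x') (z : F₁) : F₂ :=
  if hz : z ∈ K₁ ⊔ Submodule.span ℚ (range x) then
    ((_h.fieldEquiv ⟨z, mem_adjoinField_of_mem_sup hz⟩ :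
      IntermediateField.adjoin (fieldOf K₂) (allGens x')) : F₂)
  else 0

/-- On `K₁ + ℚx` the transport map is the field isomorphism `θ`. [folklore] -/
theorem IsGammaIsoTw₂.transport_eq (h : IsGammaIsoTw₂ σ x x') {z : F₁}
    (hz : z ∈ K₁ ⊔ Submodule.span ℚ (range x)) :
    h.transport z = (h.fieldEquiv ⟨z, mem_adjoinField_of_mem_sup hz⟩ : F₂) := by
  classical
  simp only [IsGammaIsoTw₂.transport, dif_pos hz]

/-- `θ` at an element of `K₁ + ℚx`, with any membership proof. [folklore] -/
theorem IsGammaIsoTw₂.coe_fieldEquiv_eq_transport (h : IsGammaIsoTw₂ σ x x') {z : F₁}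
    (hz : z ∈ K₁ ⊔ Submodule.span ℚ (range x))
    (hz' : z ∈ IntermediateField.adjoin (fieldOf K₁) (allGens x)) :
    (h.fieldEquiv ⟨z, hz'⟩ : F₂) = h.transport z := by
  rw [h.transport_eq hz]

/-- The transport of an element of `K₁ + ℚx` lies in `K₂ + ℚx'`. [cite: BaysKirby2018ANT, Def. 3.10] -/
theorem IsGammaIsoTw₂.transport_mem (h : IsGammaIsoTw₂ σ x x') (hσ : IsEBaseIso₂ K₁ K₂ σ) {z : F₁}
    (hz : z ∈ K₁ ⊔ Submodule.span ℚ (range x)) :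
    h.transport z ∈ K₂ ⊔ Submodule.span ℚ (range x') := by
  rw [h.transport_eq hz]
  exact (h.fieldEquiv_exp hσ hz).1

/-- The transport map commutes with `exp` on `K₁ + ℚx`. [cite: BaysKirby2018ANT, Def. 3.10] -/
theorem IsGammaIsoTw₂.coe_fieldEquiv_exp (h : IsGammaIsoTw₂ σ x x') (hσ : IsEBaseIso₂ K₁ K₂ σ)
    {z : F₁} (hz : z ∈ K₁ ⊔ Submodule.span ℚ (range x))
    (hez : exp z ∈ IntermediateField.adjoin (fieldOf K₁) (allGens x)) :
    (h.fieldEquiv ⟨exp z, hez⟩ : F₂) = exp (h.transport z) := by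
  rw [h.transport_eq hz]
  exact (h.fieldEquiv_exp hσ hz).2

/-- The transport map is additive on `K₁ + ℚx`. [folklore] -/
theorem IsGammaIsoTw₂.transport_add (h : IsGammaIsoTw₂ σ x x') {z w : F₁}
    (hz : z ∈ K₁ ⊔ Submodule.span ℚ (range x)) (hw : w ∈ K₁ ⊔ Submodule.span ℚ (range x)) :
    h.transport (z + w) = h.transport z + h.transport w := by
  rw [h.transport_eq hz, h.transport_eq hw, h.transport_eq (add_mem hz hw)]
  have : (⟨z + w, mem_adjoinField_of_mem_sup (add_mem hz hw)⟩ :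
      IntermediateField.adjoin (fieldOf K₁) (allGens x)) =
      ⟨z, mem_adjoinField_of_mem_sup hz⟩ + ⟨w, mem_adjoinField_of_mem_sup hw⟩ := rfl
  rw [this, map_add]
  rfl

/-- **The transport map is `σ` on `K₁⁰ ∩ (K₁ + ℚx)`.** [folklore] -/
theorem IsGammaIsoTw₂.transport_of_mem_fieldOf (h : IsGammaIsoTw₂ σ x x') {z : F₁}
    (hzK : z ∈ fieldOf K₁) (hz : z ∈ K₁ ⊔ Submodule.span ℚ (range x)) :
    h.transport z = σ ⟨z, hzK⟩ := by
  rw [h.transport_eq hz]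
  exact h.coe_fieldEquiv_algebraMap ⟨z, hzK⟩

/-- The transport map is `σ` on `K₁`. [folklore] -/
theorem IsGammaIsoTw₂.transport_of_mem (h : IsGammaIsoTw₂ σ x x') {z : F₁} (hz : z ∈ K₁) :
    h.transport z = σ ⟨z, mem_fieldOf_of_mem hz⟩ :=
  h.transport_of_mem_fieldOf (mem_fieldOf_of_mem hz) (Submodule.mem_sup_left hz)

/-- In particular the transport of an element of `K₁` lies in `K₂`. [folklore] -/
theorem IsGammaIsoTw₂.transport_mem_of_mem (h : IsGammaIsoTw₂ σ x x') (hσ : IsEBaseIso₂ K₁ K₂ σ)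
    {z : F₁} (hz : z ∈ K₁) : h.transport z ∈ K₂ := by
  rw [h.transport_of_mem hz]
  exact hσ.map_mem hz

/-- The transport map is `σ`-semilinear against `K₁⁰` on `K₁ + ℚx`. [folklore] -/
theorem IsGammaIsoTw₂.transport_mul_of_mem_fieldOf (h : IsGammaIsoTw₂ σ x x') {k z : F₁}
    (hk : k ∈ fieldOf K₁) (hz : z ∈ K₁ ⊔ Submodule.span ℚ (range x))
    (hkz : k * z ∈ K₁ ⊔ Submodule.span ℚ (range x)) :
    h.transport (k * z) = σ ⟨k, hk⟩ * h.transport z := by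
  rw [h.transport_eq hz, h.transport_eq hkz]
  have : (⟨k * z, mem_adjoinField_of_mem_sup hkz⟩ :
      IntermediateField.adjoin (fieldOf K₁) (allGens x)) =
      ⟨k, (IntermediateField.adjoin (fieldOf K₁) (allGens x)).algebraMap_mem ⟨k, hk⟩⟩ *
        ⟨z, mem_adjoinField_of_mem_sup hz⟩ := rfl
  rw [this, map_mul]
  show ((h.fieldEquiv _ : IntermediateField.adjoin (fieldOf K₂) (allGens x')) : F₂) * _ = _
  rw [h.coe_fieldEquiv_algebraMap ⟨k, hk⟩]

/-- The transport map is `ℚ`-linear on `K₁ + ℚx`. [folklore] -/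
theorem IsGammaIsoTw₂.transport_smul (h : IsGammaIsoTw₂ σ x x') (q : ℚ) {z : F₁}
    (hz : z ∈ K₁ ⊔ Submodule.span ℚ (range x)) :
    h.transport (q • z) = q • h.transport z := by
  rw [Rat.smul_def, Rat.smul_def]
  have hq : ((q : ℚ) : F₁) ∈ fieldOf K₁ := ((fieldOf K₁).algebraMap_mem (q : ℚ) :
    ((algebraMap ℚ F₁ q) ∈ fieldOf K₁))
  rw [h.transport_mul_of_mem_fieldOf hq hz (by rw [← Rat.smul_def]; exact Submodule.smul_mem _ _ hz)]
  congr 1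
  have : (⟨(q : F₁), hq⟩ : fieldOf K₁) = (q : fieldOf K₁) := Subtype.ext rfl
  rw [this, map_ratCast]
  rfl

/-- The transport map sends `xᵢ ↦ x'ᵢ`. [folklore] -/
theorem IsGammaIsoTw₂.transport_apply (h : IsGammaIsoTw₂ σ x x') (i : Fin N) :
    h.transport (x i) = x' i := by
  have hxi : x i ∈ K₁ ⊔ Submodule.span ℚ (range x) :=
    Submodule.mem_sup_right (Submodule.subset_span (mem_range_self i))
  rw [h.transport_eq hxi]
  exact h.coe_fieldEquiv_apply i _

/-- The transport of `∑ qᵢ • xᵢ` is `∑ qᵢ • x'ᵢ`. [folklore] -/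
theorem IsGammaIsoTw₂.transport_sum_smul (h : IsGammaIsoTw₂ σ x x') (q : Fin N → ℚ) :
    h.transport (∑ i, q i • x i) = ∑ i, q i • x' i := by
  have hxi : ∀ i, x i ∈ K₁ ⊔ Submodule.span ℚ (range x) := fun i =>
    Submodule.mem_sup_right (Submodule.subset_span (mem_range_self i))
  have hsum : ∀ s : Finset (Fin N), (∑ i ∈ s, q i • x i) ∈ K₁ ⊔ Submodule.span ℚ (range x) :=
    fun s => Submodule.sum_mem _ fun i _ => Submodule.smul_mem _ _ (hxi i)
  induction (Finset.univ : Finset (Fin N)) using Finset.induction_on with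
  | empty =>
    rw [Finset.sum_empty, Finset.sum_empty, h.transport_of_mem (zero_mem K₁)]
    have : (⟨(0 : F₁), mem_fieldOf_of_mem (zero_mem K₁)⟩ : fieldOf K₁) = 0 := Subtype.ext rfl
    rw [this, map_zero]; rfl
  | insert i s hi ih =>
    rw [Finset.sum_insert hi, Finset.sum_insert hi,
      h.transport_add (Submodule.smul_mem _ _ (hxi i)) (hsum s), ih,
      h.transport_smul (q i) (hxi i), h.transport_apply]

/-- The transport of `κ + ∑ qᵢ • xᵢ` (`κ ∈ K₁`) is `σ κ + ∑ qᵢ • x'ᵢ`. [folklore] -/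
theorem IsGammaIsoTw₂.transport_add_sum_smul (h : IsGammaIsoTw₂ σ x x') {κ : F₁} (hκ : κ ∈ K₁)
    (q : Fin N → ℚ) :
    h.transport (κ + ∑ i, q i • x i) = σ ⟨κ, mem_fieldOf_of_mem hκ⟩ + ∑ i, q i • x' i := by
  have hxi : ∀ i, x i ∈ K₁ ⊔ Submodule.span ℚ (range x) := fun i =>
    Submodule.mem_sup_right (Submodule.subset_span (mem_range_self i))
  have hsum : (∑ i, q i • x i) ∈ K₁ ⊔ Submodule.span ℚ (range x) :=
    Submodule.sum_mem _ fun i _ => Submodule.smul_mem _ _ (hxi i)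
  rw [h.transport_add (Submodule.mem_sup_left hκ) hsum, h.transport_of_mem hκ, h.transport_sum_smul]

/-! ### Transfer along re-basings -/

/-- **Transfer of a cross Γ-isomorphism to a tuple from `K₁ + ℚx`.** If `x ↦ x'` is a
Γ-isomorphism over `σ` (an isomorphism of base Γ-fields) and `y` is a finite tuple from
`K₁ + ℚx`, then `y ↦ θ(y)` is a Γ-isomorphism over `σ`. [cite: BaysKirby2018ANT, Def. 3.10, Def. 3.15] -/
theorem IsGammaIsoTw₂.transfer (h : IsGammaIsoTw₂ σ x x') (hσ : IsEBaseIso₂ K₁ K₂ σ) {m : ℕ}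
    {y : Fin m → F₁} (hy : ∀ j, y j ∈ K₁ ⊔ Submodule.span ℚ (range x)) :
    IsGammaIsoTw₂ σ y (fun j => h.transport (y j)) := by
  classical
  set Ey := IntermediateField.adjoin (fieldOf K₁) (allGens y) with hEy
  set Ex := IntermediateField.adjoin (fieldOf K₁) (allGens x) with hEx
  set Ex' := IntermediateField.adjoin (fieldOf K₂) (allGens x') with hEx'
  have hle : Ey ≤ Ex := adjoinField_allGens_le_of_forall_mem hy
  let θ : Ey →+* F₂ :=
    ((algebraMap Ex' F₂).comp (h.fieldEquiv : Ex →+* Ex')).comp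
      (IntermediateField.inclusion hle : Ey →+* Ex)
  have hθ : ∀ (z : F₁) (hz : z ∈ Ey), θ ⟨z, hz⟩ = (h.fieldEquiv ⟨z, hle hz⟩ : F₂) := fun z hz => rfl
  have hsub := sup_span_le_of_forall_mem hy
  refine isGammaIsoTw₂_of_ringHom θ (fun k => ?_) (fun j => ?_) (fun z hz => ?_)
  · rw [hθ]; exact h.coe_fieldEquiv_algebraMap k
  · rw [hθ, h.coe_fieldEquiv_eq_transport (hy j)]
  · rw [hθ, hθ, h.coe_fieldEquiv_exp hσ (hsub hz), h.coe_fieldEquiv_eq_transport (hsub hz)]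

/-- The transported tuple lies in `K₂ + ℚx'`. [folklore] -/
theorem IsGammaIsoTw₂.transport_mem_of_forall_mem (h : IsGammaIsoTw₂ σ x x') (hσ : IsEBaseIso₂ K₁ K₂ σ)
    {m : ℕ} {y : Fin m → F₁} (hy : ∀ j, y j ∈ K₁ ⊔ Submodule.span ℚ (range x)) (j : Fin m) :
    h.transport (y j) ∈ K₂ ⊔ Submodule.span ℚ (range x') :=
  h.transport_mem hσ (hy j)

/-- **The generated subspaces correspond.** If moreover `x` lies in `K₁ + ℚy`, then
`K₂ + ℚθ(y) = K₂ + ℚx'`. [folklore] -/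
theorem IsGammaIsoTw₂.sup_span_transport_eq (h : IsGammaIsoTw₂ σ x x') (hσ : IsEBaseIso₂ K₁ K₂ σ)
    {m : ℕ} {y : Fin m → F₁} (hy : ∀ j, y j ∈ K₁ ⊔ Submodule.span ℚ (range x))
    (hx : ∀ i, x i ∈ K₁ ⊔ Submodule.span ℚ (range y)) :
    K₂ ⊔ Submodule.span ℚ (range fun j => h.transport (y j)) =
      K₂ ⊔ Submodule.span ℚ (range x') := by
  refine le_antisymm (sup_span_le_of_forall_mem fun j => h.transport_mem hσ (hy j)) ?_
  refine sup_span_le_of_forall_mem fun i => ?_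
  obtain ⟨κ, hκ, s, hs, hxs⟩ := Submodule.mem_sup.1 (hx i)
  obtain ⟨q, rfl⟩ := (Submodule.mem_span_range_iff_exists_fun ℚ).1 hs
  have key : x' i = σ ⟨κ, mem_fieldOf_of_mem hκ⟩ + ∑ j, q j • h.transport (y j) := by
    rw [← h.transport_apply i, ← hxs]
    have hsum : ∀ t : Finset (Fin m), (∑ j ∈ t, q j • y j) ∈ K₁ ⊔ Submodule.span ℚ (range x) :=
      fun t => Submodule.sum_mem _ fun j _ => Submodule.smul_mem _ _ (hy j)
    rw [h.transport_add (Submodule.mem_sup_left hκ) (hsum _), h.transport_of_mem hκ]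
    congr 1
    induction (Finset.univ : Finset (Fin m)) using Finset.induction_on with
    | empty =>
      rw [Finset.sum_empty, Finset.sum_empty, h.transport_of_mem (zero_mem K₁)]
      have : (⟨(0 : F₁), mem_fieldOf_of_mem (zero_mem K₁)⟩ : fieldOf K₁) = 0 := Subtype.ext rfl
      rw [this, map_zero]; rfl
    | insert j t hj ih =>
      rw [Finset.sum_insert hj, Finset.sum_insert hj,
        h.transport_add (Submodule.smul_mem _ _ (hy j)) (hsum t), ih, h.transport_smul (q j) (hy j)]
  rw [key]
  refine add_mem (Submodule.mem_sup_left (hσ.map_mem hκ)) (Submodule.mem_sup_right ?_)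
  exact Submodule.sum_mem _ fun j _ =>
    Submodule.smul_mem _ _ (Submodule.subset_span (mem_range_self j))

/-! ### Linear independence over the base -/

section LinIndep

variable {c : Fin N → F₁} {c' : Fin N → F₂}

/-- A cross Γ-isomorphism `c ↦ c'` transports linear independence over the base. [folklore] -/
theorem IsGammaIsoTw₂.linIndepOver (h : IsGammaIsoTw₂ σ c c') (hσ : IsEBaseIso₂ K₁ K₂ σ)
    (hc : LinIndepOver K₁ c) : LinIndepOver K₂ c' := by
  intro q hq
  have key : h.symm.transport (∑ i, q i • c' i) = ∑ i, q i • c i := h.symm.transport_sum_smul q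
  have h2 : h.symm.transport (∑ i, q i • c' i) ∈ K₁ := h.symm.transport_mem_of_mem hσ.symm hq
  rw [key] at h2
  exact hc q h2

end LinIndep

/-! ### `θ⁻¹` and the inverse cross Γ-isomorphism -/

section Symm

variable {c : Fin N → F₁} {c' : Fin N → F₂}

/-- `θ⁻¹` is the field isomorphism of the inverse cross Γ-isomorphism (both are `σ⁻¹` on `K₂⁰`
and send `lvGens M c' ↦ lvGens M c`). [folklore] -/
theorem IsGammaIsoTw₂.coe_fieldEquiv_symm_eq (h : IsGammaIsoTw₂ σ c c')
    (z : IntermediateField.adjoin (fieldOf K₂) (allGens c')) :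
    (h.fieldEquiv.symm z : F₁) = (h.symm.fieldEquiv z : F₁) := by
  let θ : IntermediateField.adjoin (fieldOf K₂) (allGens c') →+* F₁ :=
    (algebraMap (IntermediateField.adjoin (fieldOf K₁) (allGens c)) F₁).comp
      (h.fieldEquiv.symm : _ →+* _)
  have hθ : ∀ w, θ w = (h.fieldEquiv.symm w : F₁) := fun _ => rfl
  rw [← hθ]
  refine h.symm.ringHom_eq_fieldEquiv θ (fun k => ?_) (fun M j => ?_) z
  · rw [hθ]
    have e : h.fieldEquiv ⟨σ.symm k, (IntermediateField.adjoin (fieldOf K₁) (allGens c)).algebraMap_mem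
        (σ.symm k)⟩ = ⟨k, (IntermediateField.adjoin (fieldOf K₂) (allGens c')).algebraMap_mem k⟩ := by
      apply Subtype.ext
      rw [h.coe_fieldEquiv_algebraMap (σ.symm k), RingEquiv.apply_symm_apply]
    rw [← e, RingEquiv.symm_apply_apply]
  · rw [hθ]
    have e : h.fieldEquiv ⟨lvGens M c j, mem_adjoinField_of_mem_adjoin
        (lvAlgebra_le_adjoin_allGens K₁ M c (lvGens_mem_lvAlgebra K₁ M c j))⟩ =
        ⟨lvGens M c' j, mem_adjoinField_of_mem_adjoin
          (lvAlgebra_le_adjoin_allGens K₂ M c' (lvGens_mem_lvAlgebra K₂ M c' j))⟩ :=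
      Subtype.ext (h.coe_fieldEquiv_lvGens M j)
    rw [← e, RingEquiv.symm_apply_apply]

/-- The transport maps of `h` and `h.symm` are mutually inverse on `K₁ + ℚc`. [folklore] -/
theorem IsGammaIsoTw₂.transport_symm_transport (h : IsGammaIsoTw₂ σ c c') (hσ : IsEBaseIso₂ K₁ K₂ σ)
    {z : F₁} (hz : z ∈ K₁ ⊔ Submodule.span ℚ (range c)) : h.symm.transport (h.transport z) = z := by
  rw [h.symm.transport_eq (h.transport_mem hσ hz), ← h.coe_fieldEquiv_symm_eq]
  have e : (⟨h.transport z, mem_adjoinField_of_mem_sup (h.transport_mem hσ hz)⟩ :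
      IntermediateField.adjoin (fieldOf K₂) (allGens c')) =
      h.fieldEquiv ⟨z, mem_adjoinField_of_mem_sup hz⟩ :=
    Subtype.ext (h.transport_eq hz)
  rw [e, RingEquiv.symm_apply_apply]

end Symm

/-! ### Cross Γ-isomorphisms preserve predimension -/

section Predim

variable {k : ℕ} {c : Fin N → F₁} {c' : Fin N → F₂}

/-- `θ` maps the generators `gens Λ` onto `gens Λ'` whenever `Λ ≤ K₁ + ℚc`, `Λ' ≤ K₂ + ℚc'`
correspond under the transport maps (as a statement about preimages in `⟨K₁ c⟩`). [folklore] -/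
theorem IsGammaIsoTw₂.image_fieldEquiv_preimage_gens (h : IsGammaIsoTw₂ σ c c')
    (hσ : IsEBaseIso₂ K₁ K₂ σ) {Λ : Submodule ℚ F₁} {Λ' : Submodule ℚ F₂}
    (hΛ : Λ ≤ K₁ ⊔ Submodule.span ℚ (range c)) (hΛ' : Λ' ≤ K₂ ⊔ Submodule.span ℚ (range c'))
    (hto : ∀ z ∈ Λ, h.transport z ∈ Λ') (hfrom : ∀ z ∈ Λ', h.symm.transport z ∈ Λ) :
    (h.fieldEquiv : IntermediateField.adjoin (fieldOf K₁) (allGens c) →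
        IntermediateField.adjoin (fieldOf K₂) (allGens c')) ''
        ((Subtype.val : IntermediateField.adjoin (fieldOf K₁) (allGens c) → F₁) ⁻¹' gens Λ) =
      (Subtype.val : IntermediateField.adjoin (fieldOf K₂) (allGens c') → F₂) ⁻¹' gens Λ' := by
  have hσ' := hσ.symm
  ext w
  simp only [mem_image, mem_preimage]
  constructor
  · rintro ⟨a, ha, rfl⟩
    rcases (mem_gens_iff.1 ha) with ha | ⟨d, hd, hda⟩
    · have e : a = ⟨(a : F₁), mem_adjoinField_of_mem_sup (hΛ ha)⟩ := Subtype.ext rfl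
      rw [e, h.coe_fieldEquiv_eq_transport (hΛ ha)]
      exact mem_gens_of_mem (hto _ ha)
    · have e : a = ⟨exp d, exp_mem_adjoinField_of_mem (hΛ hd)⟩ := Subtype.ext hda.symm
      rw [e, h.coe_fieldEquiv_exp hσ (hΛ hd)]
      exact exp_mem_gens (hto _ hd)
  · intro hw
    refine ⟨h.fieldEquiv.symm w, ?_, RingEquiv.apply_symm_apply _ _⟩
    rcases (mem_gens_iff.1 hw) with hw | ⟨d, hd, hdw⟩
    · have e : w = ⟨(w : F₂), mem_adjoinField_of_mem_sup (hΛ' hw)⟩ := Subtype.ext rfl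
      rw [e, h.coe_fieldEquiv_symm_eq, h.symm.coe_fieldEquiv_eq_transport (hΛ' hw)]
      exact mem_gens_of_mem (hfrom _ hw)
    · have e : w = ⟨exp d, exp_mem_adjoinField_of_mem (hΛ' hd)⟩ := Subtype.ext hdw.symm
      rw [e, h.coe_fieldEquiv_symm_eq, h.symm.coe_fieldEquiv_exp hσ' (hΛ' hd)]
      exact exp_mem_gens (hfrom _ hd)

/-- **Cross Γ-isomorphisms preserve transcendence degrees**: if `Λ₁, Λ₂ ≤ K₁ + ℚc` (in `F₁`)
correspond to `Λ₁', Λ₂' ≤ K₂ + ℚc'` (in `F₂`) under the transport maps, then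
`td(Λ₂/Λ₁) = td(Λ₂'/Λ₁')`. [cite: BaysKirby2018ANT, Def. 3.10, Def. 4.1] -/
theorem IsGammaIsoTw₂.td_eq_of_transport (h : IsGammaIsoTw₂ σ c c') (hσ : IsEBaseIso₂ K₁ K₂ σ)
    {Λ₁ Λ₂ : Submodule ℚ F₁} {Λ₁' Λ₂' : Submodule ℚ F₂}
    (h₁ : Λ₁ ≤ K₁ ⊔ Submodule.span ℚ (range c)) (h₂ : Λ₂ ≤ K₁ ⊔ Submodule.span ℚ (range c))
    (h₁' : Λ₁' ≤ K₂ ⊔ Submodule.span ℚ (range c')) (h₂' : Λ₂' ≤ K₂ ⊔ Submodule.span ℚ (range c'))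
    (hto₁ : ∀ z ∈ Λ₁, h.transport z ∈ Λ₁') (hfrom₁ : ∀ z ∈ Λ₁', h.symm.transport z ∈ Λ₁)
    (hto₂ : ∀ z ∈ Λ₂, h.transport z ∈ Λ₂') (hfrom₂ : ∀ z ∈ Λ₂', h.symm.transport z ∈ Λ₂) :
    td Λ₁ Λ₂ = td Λ₁' Λ₂' := by
  set E := IntermediateField.adjoin (fieldOf K₁) (allGens c) with hE
  set E' := IntermediateField.adjoin (fieldOf K₂) (allGens c') with hE'
  have hgens : ∀ {Λ : Submodule ℚ F₁}, Λ ≤ K₁ ⊔ Submodule.span ℚ (range c) →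
      gens Λ ⊆ (E : Set F₁) := by
    intro Λ hΛ z hz
    rcases mem_gens_iff.1 hz with hz | ⟨d, hd, rfl⟩
    · exact mem_adjoinField_of_mem_sup (hΛ hz)
    · exact exp_mem_adjoinField_of_mem (hΛ hd)
  have hgens' : ∀ {Λ : Submodule ℚ F₂}, Λ ≤ K₂ ⊔ Submodule.span ℚ (range c') →
      gens Λ ⊆ (E' : Set F₂) := by
    intro Λ hΛ z hz
    rcases mem_gens_iff.1 hz with hz | ⟨d, hd, rfl⟩
    · exact mem_adjoinField_of_mem_sup (hΛ hz)
    · exact exp_mem_adjoinField_of_mem (hΛ hd)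
  have himg : ∀ {S : Set F₁}, S ⊆ (E : Set F₁) → (Subtype.val : E → F₁) '' (Subtype.val ⁻¹' S) = S :=
    fun hS => image_preimage_eq_of_subset (by rwa [Subtype.range_coe])
  have himg' : ∀ {S : Set F₂}, S ⊆ (E' : Set F₂) →
      (Subtype.val : E' → F₂) '' (Subtype.val ⁻¹' S) = S :=
    fun hS => image_preimage_eq_of_subset (by rwa [Subtype.range_coe])
  rw [td_def, td_def, ← himg (hgens h₁), ← himg (hgens h₂), ← himg' (hgens' h₁'),
    ← himg' (hgens' h₂')]
  have r1 := MatroidComap.relRank_image_ringHom (algebraMap E F₁) (algebraMap E F₁).injective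
    ((Subtype.val : E → F₁) ⁻¹' gens Λ₁) ((Subtype.val : E → F₁) ⁻¹' gens Λ₂)
  have r2 := MatroidComap.relRank_image_ringHom (algebraMap E' F₂) (algebraMap E' F₂).injective
    ((Subtype.val : E' → F₂) ⁻¹' gens Λ₁') ((Subtype.val : E' → F₂) ⁻¹' gens Λ₂')
  have r3 := MatroidComap.relRank_image_ringHom (h.fieldEquiv : E →+* E') h.fieldEquiv.injective
    ((Subtype.val : E → F₁) ⁻¹' gens Λ₁) ((Subtype.val : E → F₁) ⁻¹' gens Λ₂)
  have i1 := h.image_fieldEquiv_preimage_gens hσ h₁ h₁' hto₁ hfrom₁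
  have i2 := h.image_fieldEquiv_preimage_gens hσ h₂ h₂' hto₂ hfrom₂
  change (algMatroid F₁).relRank ((algebraMap E F₁) '' _) ((algebraMap E F₁) '' _) =
    (algMatroid F₂).relRank ((algebraMap E' F₂) '' _) ((algebraMap E' F₂) '' _)
  rw [r1, r2, ← r3]
  change (AlgebraicIndependent.matroid ℚ E').relRank ((h.fieldEquiv : E → E') '' _)
    ((h.fieldEquiv : E → E') '' _) = _
  rw [i1, i2]

/-- **`td(c/K₁) = td(c'/K₂)`** for a cross Γ-isomorphism `c ↦ c'` over an isomorphism of base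
Γ-fields. [cite: BaysKirby2018ANT, Def. 3.10, Def. 4.1] -/
theorem IsGammaIsoTw₂.td_span_eq (h : IsGammaIsoTw₂ σ c c') (hσ : IsEBaseIso₂ K₁ K₂ σ) :
    td K₁ (Submodule.span ℚ (range c)) = td K₂ (Submodule.span ℚ (range c')) := by
  have hs := h.symm
  have hσ' := hσ.symm
  rw [← td_sup_left K₁, ← td_sup_left K₂]
  refine h.td_eq_of_transport hσ le_sup_left le_rfl le_sup_left le_rfl
    (fun z hz => h.transport_mem_of_mem hσ hz) (fun z hz => hs.transport_mem_of_mem hσ' hz)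
    (fun z hz => h.transport_mem hσ hz) (fun z hz => hs.transport_mem hσ' hz)

/-- **`δ(c/K₁) = δ(c'/K₂)`** for a cross Γ-isomorphism `c ↦ c'` with `c` linearly independent
over `K₁`. [cite: BaysKirby2018ANT, Def. 4.1] -/
theorem IsGammaIsoTw₂.predim_span_eq (h : IsGammaIsoTw₂ σ c c') (hσ : IsEBaseIso₂ K₁ K₂ σ)
    (hind : LinIndepOver K₁ c) :
    predim K₁ (Submodule.span ℚ (range c)) = predim K₂ (Submodule.span ℚ (range c')) := by
  rw [predim_def, predim_def, h.td_span_eq hσ, ldim_span_eq_of_linIndepOver hind,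
    ldim_span_eq_of_linIndepOver (h.linIndepOver hσ hind)]

/-- The transport of `(c, e) ↦ (c', e')` sends `∑ qⱼ eⱼ ↦ ∑ qⱼ e'ⱼ`. [folklore] -/
theorem IsGammaIsoTw₂.transport_sum_smul_right {e : Fin k → F₁} {e' : Fin k → F₂}
    (h : IsGammaIsoTw₂ σ (Fin.append c e) (Fin.append c' e')) (q : Fin k → ℚ) :
    h.transport (∑ j, q j • e j) = ∑ j, q j • e' j := by
  have := h.transport_sum_smul (Fin.append (0 : Fin N → ℚ) q)
  rw [Fin.sum_univ_add, Fin.sum_univ_add] at this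
  simpa only [Fin.append_left, Fin.append_right, Pi.zero_apply, zero_smul, Finset.sum_const_zero,
    zero_add] using this

/-- The transport of `(c, e) ↦ (c', e')` sends `K₁ + ℚc` into `K₂ + ℚc'`. [folklore] -/
theorem IsGammaIsoTw₂.transport_mem_left {e : Fin k → F₁} {e' : Fin k → F₂}
    (h : IsGammaIsoTw₂ σ (Fin.append c e) (Fin.append c' e')) (hσ : IsEBaseIso₂ K₁ K₂ σ) {z : F₁}
    (hz : z ∈ K₁ ⊔ Submodule.span ℚ (range c)) :
    h.transport z ∈ K₂ ⊔ Submodule.span ℚ (range c') := by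
  obtain ⟨κ, hκ, y, hy, rfl⟩ := Submodule.mem_sup.1 hz
  obtain ⟨q, rfl⟩ := (Submodule.mem_span_range_iff_exists_fun ℚ).1 hy
  have := h.transport_add_sum_smul hκ (Fin.append q (0 : Fin k → ℚ))
  rw [Fin.sum_univ_add, Fin.sum_univ_add] at this
  simp only [Fin.append_left, Fin.append_right, Pi.zero_apply, zero_smul, Finset.sum_const_zero,
    add_zero] at this
  rw [this]
  exact add_mem (Submodule.mem_sup_left (hσ.map_mem hκ)) (Submodule.mem_sup_right
    (Submodule.sum_mem _ fun i _ => Submodule.smul_mem _ _ (Submodule.subset_span (mem_range_self i))))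

/-- The transport of `(c, e) ↦ (c', e')` sends `(K₁ + ℚc) + ℚe` into `(K₂ + ℚc') + ℚe'`.
[folklore] -/
theorem IsGammaIsoTw₂.transport_mem_sup_sup {e : Fin k → F₁} {e' : Fin k → F₂}
    (h : IsGammaIsoTw₂ σ (Fin.append c e) (Fin.append c' e')) (hσ : IsEBaseIso₂ K₁ K₂ σ) {z : F₁}
    (hz : z ∈ (K₁ ⊔ Submodule.span ℚ (range c)) ⊔ Submodule.span ℚ (range e)) :
    h.transport z ∈ (K₂ ⊔ Submodule.span ℚ (range c')) ⊔ Submodule.span ℚ (range e') := by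
  obtain ⟨d, hd, y, hy, rfl⟩ := Submodule.mem_sup.1 hz
  obtain ⟨q, rfl⟩ := (Submodule.mem_span_range_iff_exists_fun ℚ).1 hy
  have hd' : d ∈ K₁ ⊔ Submodule.span ℚ (range (Fin.append c e)) := by
    rw [range_append, Submodule.span_union, ← sup_assoc]; exact Submodule.mem_sup_left hd
  have hy' : (∑ j, q j • e j) ∈ K₁ ⊔ Submodule.span ℚ (range (Fin.append c e)) := by
    rw [range_append, Submodule.span_union, ← sup_assoc]
    exact Submodule.mem_sup_right (Submodule.sum_mem _ fun j _ =>
      Submodule.smul_mem _ _ (Submodule.subset_span (mem_range_self j)))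
  rw [h.transport_add hd' hy', h.transport_sum_smul_right]
  exact add_mem (Submodule.mem_sup_left (h.transport_mem_left hσ hd)) (Submodule.mem_sup_right
    (Submodule.sum_mem _ fun j _ => Submodule.smul_mem _ _ (Submodule.subset_span (mem_range_self j))))

/-- **Cross Γ-isomorphic extensions have the same transcendence degree over the bases**:
`td(e/K₁ + ℚc) = td(e'/K₂ + ℚc')`. [cite: BaysKirby2018ANT, Def. 3.10, Def. 4.1] -/
theorem IsGammaIsoTw₂.td_sup_span_eq {e : Fin k → F₁} {e' : Fin k → F₂}
    (h : IsGammaIsoTw₂ σ (Fin.append c e) (Fin.append c' e')) (hσ : IsEBaseIso₂ K₁ K₂ σ) :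
    td (K₁ ⊔ Submodule.span ℚ (range c)) (Submodule.span ℚ (range e)) =
      td (K₂ ⊔ Submodule.span ℚ (range c')) (Submodule.span ℚ (range e')) := by
  have hs := h.symm
  have hσ' := hσ.symm
  refine h.td_eq_of_transport hσ ?_ ?_ ?_ ?_ (fun z hz => h.transport_mem_left hσ hz)
    (fun z hz => hs.transport_mem_left hσ' hz) (fun z hz => ?_) (fun z hz => ?_)
  · rw [range_append, Submodule.span_union, ← sup_assoc]; exact le_sup_left
  · rw [range_append, Submodule.span_union]; exact le_sup_right.trans le_sup_right
  · rw [range_append, Submodule.span_union, ← sup_assoc]; exact le_sup_left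
  · rw [range_append, Submodule.span_union]; exact le_sup_right.trans le_sup_right
  · obtain ⟨q, rfl⟩ := (Submodule.mem_span_range_iff_exists_fun ℚ).1 hz
    rw [h.transport_sum_smul_right]
    exact Submodule.sum_mem _ fun j _ =>
      Submodule.smul_mem _ _ (Submodule.subset_span (mem_range_self j))
  · obtain ⟨q, rfl⟩ := (Submodule.mem_span_range_iff_exists_fun ℚ).1 hz
    rw [hs.transport_sum_smul_right]
    exact Submodule.sum_mem _ fun j _ =>
      Submodule.smul_mem _ _ (Submodule.subset_span (mem_range_self j))

/-- **Cross Γ-isomorphic Γ-algebraic extensions**: if `(c, e) ↦ (c', e')` is a cross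
Γ-isomorphism with `(c, e)` linearly independent over `K₁`, then
`δ(e'/K₂ + ℚc') = δ(e/K₁ + ℚc)`. [cite: BaysKirby2018ANT, Def. 4.1] -/
theorem IsGammaIsoTw₂.predim_sup_span_eq {e : Fin k → F₁} {e' : Fin k → F₂}
    (h : IsGammaIsoTw₂ σ (Fin.append c e) (Fin.append c' e')) (hσ : IsEBaseIso₂ K₁ K₂ σ)
    (hind : LinIndepOver K₁ (Fin.append c e)) :
    predim (K₂ ⊔ Submodule.span ℚ (range c')) (Submodule.span ℚ (range e')) =
      predim (K₁ ⊔ Submodule.span ℚ (range c)) (Submodule.span ℚ (range e)) := by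
  have hind' : LinIndepOver K₂ (Fin.append c' e') := h.linIndepOver hσ hind
  rw [predim_def, predim_def, h.td_sup_span_eq hσ, ldim_span_eq_of_linIndepOver hind.right_of_append,
    ldim_span_eq_of_linIndepOver hind'.right_of_append]

end Predim

/-! ### Extension by a generic element, across the two fields -/

section GenericExt

variable {c : Fin N → F₁} {c' : Fin N → F₂}

/-- **Relation transport extends along algebraically independent families, across two
algebras.** If `P(v) = 0 ↔ P^f(w) = 0` for all `P` over `k₁` (`v` in `A`, `w` in `B`), `p` is
algebraically independent over `k₁[v]` and `q` over `k₂[w]`, then `(p, v)` and `(q, w)` correspond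
likewise. [folklore] -/
theorem aeval_sumElim_eq_zero_iff_map_of_forall₂ {k₁ k₂ A B : Type*} [CommRing k₁] [CommRing k₂]
    [CommRing A] [CommRing B] [Algebra k₁ A] [Algebra k₂ B] (f : k₁ →+* k₂) {κ ι : Type*}
    {p : κ → A} {q : κ → B} {v : ι → A} {w : ι → B}
    (hvw : ∀ P : MvPolynomial ι k₁, MvPolynomial.aeval v P = 0 ↔
      MvPolynomial.aeval w (MvPolynomial.map f P) = 0)
    (hp : AlgebraicIndependent (Algebra.adjoin k₁ (range v)) p)
    (hq : AlgebraicIndependent (Algebra.adjoin k₂ (range w)) q) (P : MvPolynomial (κ ⊕ ι) k₁) :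
    MvPolynomial.aeval (Sum.elim p v) P = 0 ↔
      MvPolynomial.aeval (Sum.elim q w) (MvPolynomial.map f P) = 0 := by
  rw [aeval_sumElim_eq_zero_iff hp, aeval_sumElim_eq_zero_iff hq, sumAlgEquiv_map_ringHom]
  simp only [MvPolynomial.coeff_map]
  exact forall_congr' fun m => hvw _

/-- **Extension of a cross Γ-isomorphism by a generic element** (uniqueness of the generic type
across two fields; Bays–Kirby 2013, Prop. 5 (i); Haykazyan 2016, Def. 2, IV(i)): if `c ↦ c'`
is a Γ-isomorphism over `σ` and `d ∈ F₁`, `d' ∈ F₂` are generic over `K₁ + ℚc`, `K₂ + ℚc'`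
(`td(d, exp d/K₁ + ℚc) = 2`, `td(d', exp d'/K₂ + ℚc') = 2`), then `(c, d) ↦ (c', d')` is a
Γ-isomorphism over `σ`. [cite: BaysKirby2013Excellence, Prop. 5 (i) (proof)]
[cite: Haykazyan2016, Def. 2] -/
theorem IsGammaIsoTw₂.append_singleton (h : IsGammaIsoTw₂ σ c c') {d : F₁} {d' : F₂}
    (hd : td (K₁ ⊔ Submodule.span ℚ (range c)) (Submodule.span ℚ {d}) = 2)
    (hd' : td (K₂ ⊔ Submodule.span ℚ (range c')) (Submodule.span ℚ {d'}) = 2) :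
    IsGammaIsoTw₂ σ (Fin.append c ![d]) (Fin.append c' ![d']) := by
  intro M P
  have hp := algebraicIndependent_lvGens_singleton K₁ M c hd
  have hq := algebraicIndependent_lvGens_singleton K₂ M c' hd'
  have e1 : MvPolynomial.aeval (lvGens M (Fin.append c ![d])) P =
      MvPolynomial.aeval (Sum.elim (lvGens M ![d]) (lvGens M c))
        (MvPolynomial.rename (appendIdx N) P) := by
    rw [MvPolynomial.aeval_rename, lvGens_append_singleton]
  have e2 : MvPolynomial.aeval (lvGens M (Fin.append c' ![d']))
        (MvPolynomial.map (σ : fieldOf K₁ →+* fieldOf K₂) P) =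
      MvPolynomial.aeval (Sum.elim (lvGens M ![d']) (lvGens M c'))
        (MvPolynomial.rename (appendIdx N) (MvPolynomial.map (σ : fieldOf K₁ →+* fieldOf K₂) P)) := by
    rw [MvPolynomial.aeval_rename, lvGens_append_singleton]
  rw [e1, e2, ← MvPolynomial.map_rename]
  exact aeval_sumElim_eq_zero_iff_map_of_forall₂ _ (h M) hp hq _

/-- The same with the genericity given by non-membership in Γ-closed subspaces `H₁ ⊇ K₁ + ℚc` of
`F₁`, `H₂ ⊇ K₂ + ℚc'` of `F₂` (Bays–Kirby 2018, Lemma 4.13: `IsStrong.sup_span_singleton`); both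
extended spans are strong. [cite: BaysKirby2018ANT, Lemma 4.13]
[cite: BaysKirby2013Excellence, Prop. 5 (i) (proof)] -/
theorem IsGammaIsoTw₂.append_singleton_of_not_mem (h : IsGammaIsoTw₂ σ c c')
    (hs : IsStrong (K₁ ⊔ Submodule.span ℚ (range c)))
    (hs' : IsStrong (K₂ ⊔ Submodule.span ℚ (range c')))
    {H₁ : Submodule ℚ F₁} {H₂ : Submodule ℚ F₂} (hH₁ : IsGammaClosed H₁) (hH₂ : IsGammaClosed H₂)
    (hle₁ : K₁ ⊔ Submodule.span ℚ (range c) ≤ H₁) (hle₂ : K₂ ⊔ Submodule.span ℚ (range c') ≤ H₂)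
    {d : F₁} {d' : F₂} (hd : d ∉ H₁) (hd' : d' ∉ H₂) :
    IsGammaIsoTw₂ σ (Fin.append c ![d]) (Fin.append c' ![d']) ∧
      IsStrong (K₁ ⊔ Submodule.span ℚ (range (Fin.append c ![d]))) ∧
      IsStrong (K₂ ⊔ Submodule.span ℚ (range (Fin.append c' ![d']))) := by
  obtain ⟨hs1, hδ1⟩ := hs.sup_span_singleton hH₁ hle₁ hd
  obtain ⟨hs2, hδ2⟩ := hs'.sup_span_singleton hH₂ hle₂ hd'
  have hdn : d ∉ K₁ ⊔ Submodule.span ℚ (range c) := fun hmem => hd (hle₁ hmem)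
  have hdn' : d' ∉ K₂ ⊔ Submodule.span ℚ (range c') := fun hmem => hd' (hle₂ hmem)
  have htd : td (K₁ ⊔ Submodule.span ℚ (range c)) (Submodule.span ℚ {d}) = 2 :=
    td_span_singleton_eq_two hdn hδ1
  have htd' : td (K₂ ⊔ Submodule.span ℚ (range c')) (Submodule.span ℚ {d'}) = 2 :=
    td_span_singleton_eq_two hdn' hδ2
  refine ⟨h.append_singleton htd htd', ?_, ?_⟩
  · rw [range_append, range_single, Submodule.span_union, ← sup_assoc]; exact hs1
  · rw [range_append, range_single, Submodule.span_union, ← sup_assoc]; exact hs2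

end GenericExt

end GammaField

end Literature.NumberTheory.Transcendental
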